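import Mathlib
import Summits.ResolutionOfSingularities.ResolutionOfSingularities.Theses.RadicialJung
import Summits.ResolutionOfSingularities.ResolutionOfSingularities.Theorems.RadicialJungCleanModelsCleanAlongValuationOfZeroDim
import Summits.ResolutionOfSingularities.ResolutionOfSingularities.Theorems.RadicialJungCleanModelsCleanLUZeroDimOfCleanModels
import Summits.ResolutionOfSingularities.ResolutionOfSingularities.Theorems.RadicialJungCleanModelsCleanAlongValuation4Census
import Summits.ResolutionOfSingularities.ResolutionOfSingularities.Theorems.RadicialJungCleanModelsCleanLUZeroDimSmall
import HarnessLib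

/-!
# Route `RadicialJung`, crux `CleanModels` (stmt-ResolutionOfSingularities-15917), skeleton `Cruxes/CleanModels/Lines/Sketch.lean` rev 35:
# THE CRUX IMPLIES ITS SUPPORT ITEM — `Theses.RadicialJung.CleanModels → Theses.RadicialJung.CleanAlongValuation4` BY NAME, and the crux
# RESTRICTED TO `dim W ≤ 4` is EQUIVALENT to stmt-18006 modulo patching (X44c ∧ hZ_4)

Explicit-unit seat `decomp-res-hand-2` g7 (share = stubs 5–7, strategy «structural»).  OURS, def-free, structural bookkeeping counted 0; nothing here
proves resolution of singularities in characteristic `p`.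

Composition of this seat's three kernel nodes: ✓ `cleanLUZeroDim_of_cleanModelsDimLE` (extraction: `CleanModels`(dim ≤ N) ⟹ `CleanLUZeroDim_{≤N}`),
✓ `cleanAlongValuation_of_cleanLUZeroDim` (constants + refinement + generisation: `CleanLUZeroDim_{≤N}` ⟹ clean LU along ONE arbitrary valuation at
regular centres of dim ≤ N) and ✓ `GradedAssembly.cleanModels_dimLEFour_of_cleanAlongValuation4` (patching: stmt-18006 ∧ X44c ∧ hZ_4 ⟹
`CleanModels`(dim ≤ 4)):

* `cleanAlongValuation_of_cleanModelsDimLE` — for every `N`: `CleanModels`(dim W ≤ N) ⟹ the body of `CleanAlongValuation4` with `4 ↦ N`;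
* `cleanAlongValuation4_of_cleanModelsDimLEFour` — `CleanModels`(dim W ≤ 4) ⟹ stmt-18006;
* `cleanAlongValuation4_of_cleanModels` — **`Theses.RadicialJung.CleanModels → Theses.RadicialJung.CleanAlongValuation4`** (the support item is a
  CONSEQUENCE of the crux, as the planner's «first lemma» intends);
* `cleanModelsDimLEFour_iff_cleanAlongValuation4` — **granted X44c (registered stub `stub_cleanProp44`, VERBATIM) and `hZ_4` (two-model patching for
  `P_clean` in trdeg 4), `CleanModels`(dim W ≤ 4) ↔ stmt-18006**: up to dimension four the crux and its support item differ EXACTLY by patching.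
-/

noncomputable section

set_option linter.dupNamespace false -- mandated namespace of this single-conjunct summit

open IsLocalRing AlgebraicGeometry CategoryTheory
open Literature.AlgebraicGeometry.Resolution Literature.AlgebraicGeometry.Motives

namespace Summit.ResolutionOfSingularities.ResolutionOfSingularities.Theorems.RadicialJung.CleanModels

/-- **`CleanModels`(dim W ≤ N) ⟹ clean LU along ONE arbitrary valuation at regular centres of dimension ≤ N** (the body of `CleanAlongValuation4`
with `4 ↦ N`): extraction (✓ `cleanLUZeroDim_of_cleanModelsDimLE`) then constants/refinement/generisation (✓ `cleanAlongValuation_of_cleanLUZeroDim`).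
[folklore] -/
theorem cleanAlongValuation_of_cleanModelsDimLE (N : ℕ)
    (hCM : ∀ p : ℕ, p.Prime → ∀ (k : Type) [Field k] [CharP k p] (W : AlgebraicGeometry.Scheme.{0}) [AlgebraicGeometry.IsIntegral W] (f : W ⟶ AlgebraicGeometry.Spec (.of k)) (L : Type) [Field L] [Algebra W.functionField L], AlgebraicGeometry.IsSeparated f → AlgebraicGeometry.LocallyOfFiniteType f → AlgebraicGeometry.QuasiCompact f → Literature.AlgebraicGeometry.Resolution.Scheme.IsRegular W → IsPurelyInseparable W.functionField L → Module.finrank W.functionField L = p → topologicalKrullDim W ≤ ((N : ℕ) : WithBot ℕ∞) → ∃ (V : AlgebraicGeometry.Scheme.{0}) (π : V ⟶ W) (_ : AlgebraicGeometry.IsIntegral V) (_ : AlgebraicGeometry.IsDominant π), AlgebraicGeometry.IsProper π ∧ Literature.AlgebraicGeometry.Resolution.IsBirational π ∧ Literature.AlgebraicGeometry.Resolution.Scheme.IsRegular V ∧ (∀ v : V, (∃ (y : L) (g : W.functionField), y ∉ Set.range (algebraMap W.functionField L) ∧ algebraMap W.functionField L g = y ^ p ∧ ((∃ (d m : ℕ)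 (hmd : m ≤ d) (t : Fin d → V.presheaf.stalk v) (a : Fin m → ℕ), Ideal.span (Set.range t) = IsLocalRing.maximalIdeal (V.presheaf.stalk v) ∧ ringKrullDim (V.presheaf.stalk v) = (d : WithBot ℕ∞) ∧ 0 < m ∧ (∀ i, ¬ p ∣ a i) ∧ Literature.AlgebraicGeometry.Motives.RatFn.functionFieldMap π g = ∏ i : Fin m, (algebraMap (V.presheaf.stalk v) V.functionField (t (Fin.castLE hmd i))) ^ (a i)) ∨ (∃ u₀ : V.presheaf.stalk v, IsUnit u₀ ∧ Literature.AlgebraicGeometry.Motives.RatFn.functionFieldMap π g = algebraMap (V.presheaf.stalk v) V.functionField u₀ ∧ ((∀ c : V.presheaf.stalk v, u₀ - c ^ p ∉ IsLocalRing.maximalIdeal (V.presheaf.stalk v)) ∨ (∃ c : V.presheaf.stalk v, u₀ - c ^ p ∈ IsLocalRing.maximalIdeal (V.presheaf.stalk v) ∧ u₀ - c ^ p ∉ IsLocalRing.maximalIdeal (V.presheaf.stalk v) ^ 2))))))) :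
    ∀ p : ℕ, p.Prime → ∀ (k K : Type) [Field k] [CharP k p] [Field K] [Algebra k K] (O : ValuationSubring K)
      (A₀ : Subalgebra k K) (h₀ : A₀.toSubring ≤ O.toSubring) (g : K), A₀.FG → IsFractionRing A₀ K → (∀ c : K, c ^ p ≠ g) →
      IsRegularLocalRing (locAtCentre A₀.toSubring O) →
      ringKrullDim (locAtCentre A₀.toSubring O) ≤ ((N : ℕ) : WithBot ℕ∞) →
      ∃ (A : Subalgebra k K) (_h : A.toSubring ≤ O.toSubring) (_ : IsRegularLocalRing (locAtCentre A.toSubring O)),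
        A₀ ≤ A ∧ A.FG ∧ ∃ c : Fin p → K, (∃ j : Fin p, (j : ℕ) ≠ 0 ∧ c j ≠ 0) ∧
        ((∃ (d m : ℕ) (hmd : m ≤ d) (t : Fin d → locAtCentre A.toSubring O) (a : Fin m → ℕ) (u : locAtCentre A.toSubring O),
            IsUnit u ∧ Ideal.span (Set.range t) = IsLocalRing.maximalIdeal (locAtCentre A.toSubring O) ∧
            ringKrullDim (locAtCentre A.toSubring O) = (d : WithBot ℕ∞) ∧ 0 < m ∧ (∀ i, ¬ p ∣ a i) ∧
            (∑ j : Fin p, c j ^ p * g ^ (j : ℕ)) =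
              (u : K) * ∏ i : Fin m, ((t (Fin.castLE hmd i) : locAtCentre A.toSubring O) : K) ^ (a i)) ∨
          (∃ u : locAtCentre A.toSubring O, IsUnit u ∧ (∑ j : Fin p, c j ^ p * g ^ (j : ℕ)) = (u : K) ∧
            ∀ c' : locAtCentre A.toSubring O, u - c' ^ p ∉ IsLocalRing.maximalIdeal (locAtCentre A.toSubring O)) ∨
          (∃ s c' : locAtCentre A.toSubring O, (∑ j : Fin p, c j ^ p * g ^ (j : ℕ)) = (s : K) ∧
            s - c' ^ p ∈ IsLocalRing.maximalIdeal (locAtCentre A.toSubring O) ∧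
            s - c' ^ p ∉ IsLocalRing.maximalIdeal (locAtCentre A.toSubring O) ^ 2)) :=
  cleanAlongValuation_of_cleanLUZeroDim N (cleanLUZeroDim_of_cleanModelsDimLE N hCM)

/-- **`CleanModels`(dim W ≤ 4) ⟹ stmt-18006** (`Theses.RadicialJung.CleanAlongValuation4`, BY NAME). [folklore] -/
theorem cleanAlongValuation4_of_cleanModelsDimLEFour
    (hCM : ∀ p : ℕ, p.Prime → ∀ (k : Type) [Field k] [CharP k p] (W : AlgebraicGeometry.Scheme.{0}) [AlgebraicGeometry.IsIntegral W] (f : W ⟶ AlgebraicGeometry.Spec (.of k)) (L : Type) [Field L] [Algebra W.functionField L], AlgebraicGeometry.IsSeparated f → AlgebraicGeometry.LocallyOfFiniteType f → AlgebraicGeometry.QuasiCompact f → Literature.AlgebraicGeometry.Resolution.Scheme.IsRegular W → IsPurelyInseparable W.functionField L → Module.finrank W.functionField L = p → topologicalKrullDim W ≤ ((4 : ℕ) : WithBot ℕ∞) → ∃ (V : AlgebraicGeometry.Scheme.{0}) (π : V ⟶ W) (_ : AlgebraicGeometry.IsIntegral V) (_ : AlgebraicGeometry.IsDominant π), AlgebraicGeometry.IsProper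 π ∧ Literature.AlgebraicGeometry.Resolution.IsBirational π ∧ Literature.AlgebraicGeometry.Resolution.Scheme.IsRegular V ∧ (∀ v : V, (∃ (y : L) (g : W.functionField), y ∉ Set.range (algebraMap W.functionField L) ∧ algebraMap W.functionField L g = y ^ p ∧ ((∃ (d m : ℕ) (hmd : m ≤ d) (t : Fin d → V.presheaf.stalk v) (a : Fin m → ℕ), Ideal.span (Set.range t) = IsLocalRing.maximalIdeal (V.presheaf.stalk v) ∧ ringKrullDim (V.presheaf.stalk v) = (d : WithBot ℕ∞) ∧ 0 < m ∧ (∀ i, ¬ p ∣ a i) ∧ Literature.AlgebraicGeometry.Motives.RatFn.functionFieldMap π g = ∏ i : Fin m, (algebraMap (V.presheaf.stalk v) V.functionField (t (Fin.castLE hmd i))) ^ (a i)) ∨ (∃ u₀ : V.presheaf.stalk v, IsUnit u₀ ∧ Literature.AlgebraicGeometry.Motives.RatFn.functionFieldMap π g = algebraMap (V.presheaf.stalk v) V.functionField u₀ ∧ ((∀ c : V.presheaf.stalk v, u₀ - c ^ p ∉ IsLocalRing.maximalIdeal (V.presheaf.stalk v)) ∨ (∃ c : V.presheaf.stalk v,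 u₀ - c ^ p ∈ IsLocalRing.maximalIdeal (V.presheaf.stalk v) ∧ u₀ - c ^ p ∉ IsLocalRing.maximalIdeal (V.presheaf.stalk v) ^ 2))))))) :
    Summit.ResolutionOfSingularities.ResolutionOfSingularities.Theses.RadicialJung.CleanAlongValuation4 :=
  cleanAlongValuation_of_cleanModelsDimLE 4 hCM

/-- **The crux implies its support item: `Theses.RadicialJung.CleanModels → Theses.RadicialJung.CleanAlongValuation4`** (stmt-15917 ⟹ stmt-18006,
BY NAME; the dimension restriction is simply dropped). [folklore] -/
theorem cleanAlongValuation4_of_cleanModels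
    (h : Summit.ResolutionOfSingularities.ResolutionOfSingularities.Theses.RadicialJung.CleanModels) :
    Summit.ResolutionOfSingularities.ResolutionOfSingularities.Theses.RadicialJung.CleanAlongValuation4 :=
  cleanAlongValuation4_of_cleanModelsDimLEFour
    (fun p hp k _ _ W _ f L _ _ hs hl hq hr hpi hd _ => h p hp k W f L hs hl hq hr hpi hd)

/-- **Up to dimension four, the crux and its support item differ exactly by PATCHING**: granted X44c (the registered research stub `stub_cleanProp44`,
VERBATIM; it gives `hZ_3` by ✓ `GradedAssembly.cleanTwoModelPatching_three_of_cleanProp44`) and `hZ_4` (open-form two-model patching for `P_clean` in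
transcendence degree 4 — Piltant's Prop. 5.1 in dimension 4, open), `CleanModels` restricted to `dim W ≤ 4` is EQUIVALENT to
`Theses.RadicialJung.CleanAlongValuation4`.  (⟹): `cleanAlongValuation4_of_cleanModelsDimLEFour` (uses neither hypothesis); (⟸): ✓
`GradedAssembly.cleanModels_dimLEFour_of_cleanAlongValuation4`. [cite: Piltant2013, Prop. 5.1 and Cor. 5.7] [cite: CossartPiltant2008, Prop. 4.4] -/
theorem cleanModelsDimLEFour_iff_cleanAlongValuation4
    (h44c : ∀ (p : ℕ), p.Prime → ∀ (S : Scheme.{0}) [IsIntegral S] [IsNoetherian S],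
      CharP S.functionField p → Scheme.IsRegular S → Scheme.IsExcellent S → topologicalKrullDim S = 3 →
      ∀ G₀ : S.functionField, (∀ s : S, CleanRegAt p (algebraMap (S.presheaf.stalk s) S.functionField) G₀) →
      ∀ I : S.IdealSheafData, I ≠ ⊥ →
      ∀ (X : Scheme.{0}) (ρ : X ⟶ S) [IsIntegral X] [IsNoetherian X] [IsDominant ρ],
        IsCleanRegularCentreBlowupSeq p ρ I G₀ →
        (∀ x : X, CleanRegAt p (algebraMap (X.presheaf.stalk x) X.functionField) (RatFn.functionFieldMap ρ G₀)) →
        ∀ (J : X.IdealSheafData) (μ : ℕ), 1 ≤ μ →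
          (∀ x ∈ J.support, 1 < Order.coheight x) → (∀ x, idealOrder J x ≤ μ) → (∃ x, idealOrder J x = μ) →
          ∃ (X' : Scheme.{0}) (π : X' ⟶ X) (_ : IsIntegral X') (_ : IsDominant π) (J' : X'.IdealSheafData),
            IsCleanPermissibleSeq p π J μ J' (RatFn.functionFieldMap ρ G₀) ∧ ∀ x, idealOrder J' x < μ)
    (hZ4 : ∀ (p : ℕ), p.Prime → ∀ (k K : Type) [Field k] [CharP k p] [Field K] [Algebra k K] [Algebra.EssFiniteType k K],
    Algebra.trdeg k K = ((4 : ℕ) : Cardinal) → ∀ (g₀ : K) (M₁ M₂ : ProjModel k K) (U₁ : M₁.X.Opens) (U₂ : M₂.X.Opens),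
    (∀ x ∈ U₁, ModelCleanRegAt p g₀ M₁ x) → (∀ x ∈ U₂, ModelCleanRegAt p g₀ M₂ x) →
    ∃ (N : ProjModel k K) (φ₁ : N.Hom M₁) (φ₂ : N.Hom M₂),
    (∀ y : N.X, φ₁.f y ∈ U₁ → ModelCleanRegAt p g₀ N y) ∧ (∀ y : N.X, φ₂.f y ∈ U₂ → ModelCleanRegAt p g₀ N y)) :
    (∀ p : ℕ, p.Prime → ∀ (k : Type) [Field k] [CharP k p] (W : AlgebraicGeometry.Scheme.{0}) [AlgebraicGeometry.IsIntegral W] (f : W ⟶ AlgebraicGeometry.Spec (.of k)) (L : Type) [Field L] [Algebra W.functionField L], AlgebraicGeometry.IsSeparated f → AlgebraicGeometry.LocallyOfFiniteType f → AlgebraicGeometry.QuasiCompact f → Literature.AlgebraicGeometry.Resolution.Scheme.IsRegular W → IsPurelyInseparable W.functionField L → Module.finrank W.functionField L = p → topologicalKrullDim W ≤ ((4 : ℕ) : WithBot ℕ∞) → ∃ (V : AlgebraicGeometry.Scheme.{0}) (π : V ⟶ W) (_ : AlgebraicGeometry.IsIntegral V) (_ : AlgebraicGeometry.IsDominant π),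 AlgebraicGeometry.IsProper π ∧ Literature.AlgebraicGeometry.Resolution.IsBirational π ∧ Literature.AlgebraicGeometry.Resolution.Scheme.IsRegular V ∧ (∀ v : V, (∃ (y : L) (g : W.functionField), y ∉ Set.range (algebraMap W.functionField L) ∧ algebraMap W.functionField L g = y ^ p ∧ ((∃ (d m : ℕ) (hmd : m ≤ d) (t : Fin d → V.presheaf.stalk v) (a : Fin m → ℕ), Ideal.span (Set.range t) = IsLocalRing.maximalIdeal (V.presheaf.stalk v) ∧ ringKrullDim (V.presheaf.stalk v) = (d : WithBot ℕ∞) ∧ 0 < m ∧ (∀ i, ¬ p ∣ a i) ∧ Literature.AlgebraicGeometry.Motives.RatFn.functionFieldMap π g = ∏ i : Fin m, (algebraMap (V.presheaf.stalk v) V.functionField (t (Fin.castLE hmd i))) ^ (a i)) ∨ (∃ u₀ : V.presheaf.stalk v, IsUnit u₀ ∧ Literature.AlgebraicGeometry.Motives.RatFn.functionFieldMap π g = algebraMap (V.presheaf.stalk v) V.functionField u₀ ∧ ((∀ c : V.presheaf.stalk v, u₀ - c ^ p ∉ IsLocalRing.maximalIdeal (V.presheaf.stalk v)) ∨ (∃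 c : V.presheaf.stalk v, u₀ - c ^ p ∈ IsLocalRing.maximalIdeal (V.presheaf.stalk v) ∧ u₀ - c ^ p ∉ IsLocalRing.maximalIdeal (V.presheaf.stalk v) ^ 2))))))) ↔
    Summit.ResolutionOfSingularities.ResolutionOfSingularities.Theses.RadicialJung.CleanAlongValuation4 :=
  ⟨fun hCM => cleanAlongValuation4_of_cleanModelsDimLEFour hCM,
    fun h18006 => GradedAssembly.cleanModels_dimLEFour_of_cleanAlongValuation4 h18006 h44c hZ4⟩

/-! ## (appended, same seat) UNCONDITIONAL up to dimension two -/

/-- **Clean local uniformization along EVERY valuation at regular centres of dimension `≤ 2` — UNCONDITIONAL** (every prime `p`, every ground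
field `k` of characteristic `p`, `K ⊇ k` finitely generated of ANY transcendence degree, `O` any valuation ring of `K`): the body of
`CleanAlongValuation4` with `4 ↦ 2` holds outright, by ✓ `cleanAlongValuation_of_cleanLUZeroDim 2` over the discharged ✓ `cleanLUZeroDim_zero` /
✓ `cleanLUZeroDim_one` / ✓ `cleanLUZeroDim_two` (the last = Giraud's clean models of surfaces, F-75c ✓ `stub_stacks0BICLocus`, localised).  In
particular the support item stmt-18006 holds at every valuation whose centre has dimension `≤ 2`. [cite: Giraud1983, Thm. 2.4] [cite: StacksProject, Tag 0BIC] -/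
theorem cleanAlongValuation_two : ∀ p : ℕ, p.Prime → ∀ (k K : Type) [Field k] [CharP k p] [Field K] [Algebra k K] (O : ValuationSubring K)
      (A₀ : Subalgebra k K) (h₀ : A₀.toSubring ≤ O.toSubring) (g : K), A₀.FG → IsFractionRing A₀ K → (∀ c : K, c ^ p ≠ g) →
      IsRegularLocalRing (locAtCentre A₀.toSubring O) →
      ringKrullDim (locAtCentre A₀.toSubring O) ≤ ((2 : ℕ) : WithBot ℕ∞) →
      ∃ (A : Subalgebra k K) (_h : A.toSubring ≤ O.toSubring) (_ : IsRegularLocalRing (locAtCentre A.toSubring O)),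
        A₀ ≤ A ∧ A.FG ∧ ∃ c : Fin p → K, (∃ j : Fin p, (j : ℕ) ≠ 0 ∧ c j ≠ 0) ∧
        ((∃ (d m : ℕ) (hmd : m ≤ d) (t : Fin d → locAtCentre A.toSubring O) (a : Fin m → ℕ) (u : locAtCentre A.toSubring O),
            IsUnit u ∧ Ideal.span (Set.range t) = IsLocalRing.maximalIdeal (locAtCentre A.toSubring O) ∧
            ringKrullDim (locAtCentre A.toSubring O) = (d : WithBot ℕ∞) ∧ 0 < m ∧ (∀ i, ¬ p ∣ a i) ∧
            (∑ j : Fin p, c j ^ p * g ^ (j : ℕ)) =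
              (u : K) * ∏ i : Fin m, ((t (Fin.castLE hmd i) : locAtCentre A.toSubring O) : K) ^ (a i)) ∨
          (∃ u : locAtCentre A.toSubring O, IsUnit u ∧ (∑ j : Fin p, c j ^ p * g ^ (j : ℕ)) = (u : K) ∧
            ∀ c' : locAtCentre A.toSubring O, u - c' ^ p ∉ IsLocalRing.maximalIdeal (locAtCentre A.toSubring O)) ∨
          (∃ s c' : locAtCentre A.toSubring O, (∑ j : Fin p, c j ^ p * g ^ (j : ℕ)) = (s : K) ∧
            s - c' ^ p ∈ IsLocalRing.maximalIdeal (locAtCentre A.toSubring O) ∧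
            s - c' ^ p ∉ IsLocalRing.maximalIdeal (locAtCentre A.toSubring O) ^ 2)) := by
  refine cleanAlongValuation_of_cleanLUZeroDim 2 (fun d hd => ?_)
  obtain rfl | rfl | rfl : d = 0 ∨ d = 1 ∨ d = 2 := by omega
  · exact cleanLUZeroDim_zero
  · exact cleanLUZeroDim_one
  · exact cleanLUZeroDim_two

/-- **`CleanModels` restricted to `dim W ≤ 2` — UNCONDITIONAL** (F-75c ✓ `stub_stacks0BICLocus` through ✓ `cleanModels_dimLETwo_of_f75c`; recorded at the
restricted-crux shape used in this file, so that the `N = 2` instance of the «local ⟺ global modulo patching» picture is a pair of theorems).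
[cite: StacksProject, Tag 0BIC] -/
theorem cleanModels_dimLETwo : ∀ p : ℕ, p.Prime → ∀ (k : Type) [Field k] [CharP k p] (W : AlgebraicGeometry.Scheme.{0}) [AlgebraicGeometry.IsIntegral W] (f : W ⟶ AlgebraicGeometry.Spec (.of k)) (L : Type) [Field L] [Algebra W.functionField L], AlgebraicGeometry.IsSeparated f → AlgebraicGeometry.LocallyOfFiniteType f → AlgebraicGeometry.QuasiCompact f → Literature.AlgebraicGeometry.Resolution.Scheme.IsRegular W → IsPurelyInseparable W.functionField L → Module.finrank W.functionField L = p → topologicalKrullDim W ≤ ((2 : ℕ) : WithBot ℕ∞) → ∃ (V : AlgebraicGeometry.Scheme.{0}) (π : V ⟶ W) (_ : AlgebraicGeometry.IsIntegral V) (_ : AlgebraicGeometry.IsDominant π), AlgebraicGeometry.IsProper π ∧ Literature.AlgebraicGeometry.Resolution.IsBirational π ∧ Literature.AlgebraicGeometry.Resolution.Scheme.IsRegular V ∧ (∀ v : V, (∃ (y : L) (g : W.functionField), y ∉ Set.range (algebraMap W.functionField L) ∧ algebraMap W.functionField L g = y ^ p ∧ ((∃ (d m : ℕ) (hmd : m ≤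 d) (t : Fin d → V.presheaf.stalk v) (a : Fin m → ℕ), Ideal.span (Set.range t) = IsLocalRing.maximalIdeal (V.presheaf.stalk v) ∧ ringKrullDim (V.presheaf.stalk v) = (d : WithBot ℕ∞) ∧ 0 < m ∧ (∀ i, ¬ p ∣ a i) ∧ Literature.AlgebraicGeometry.Motives.RatFn.functionFieldMap π g = ∏ i : Fin m, (algebraMap (V.presheaf.stalk v) V.functionField (t (Fin.castLE hmd i))) ^ (a i)) ∨ (∃ u₀ : V.presheaf.stalk v, IsUnit u₀ ∧ Literature.AlgebraicGeometry.Motives.RatFn.functionFieldMap π g = algebraMap (V.presheaf.stalk v) V.functionField u₀ ∧ ((∀ c : V.presheaf.stalk v, u₀ - c ^ p ∉ IsLocalRing.maximalIdeal (V.presheaf.stalk v)) ∨ (∃ c : V.presheaf.stalk v, u₀ - c ^ p ∈ IsLocalRing.maximalIdeal (V.presheaf.stalk v) ∧ u₀ - c ^ p ∉ IsLocalRing.maximalIdeal (V.presheaf.stalk v) ^ 2)))))) := by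
  intro p hp k _ _ W _ f L _ _ hs hl hq hr hpi hd h2
  haveI := hs; haveI := hl; haveI := hq; haveI := hpi
  exact cleanModels_dimLETwo_of_f75c stub_stacks0BICLocus p hp k W f hr L hd h2

/-! ## (appended, same seat) The registered research stubs 5 and 7 of `Sketch` rev 35 are NECESSARY for the crux -/

/-- **The class-(B) research stub is NECESSARY for the crux**: `Theses.RadicialJung.CleanModels` implies the registered rev-35 stub
`stub_cleanLU3DefectNonDiscrete` VERBATIM — all its negative hypotheses (`p ≠ 2`, immediate `K^p`-line, positive transcendence defect, not discrete,
no divisorial / proper coarsening, the `p`-rank and separable-constants frames, `k` not algebraically closed, no smooth-cone stage) are simply DROPPED: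
the crux restricted to `dim W ≤ 3` already gives `CleanLUZeroDim_3` (✓ `cleanLUZeroDim_of_cleanModelsDimLE 3`).  So stub 5 is not an artefact of the
line: any proof of `CleanModels` proves it. [folklore] -/
theorem stub_cleanLU3DefectNonDiscrete_of_cleanModels
    (h : Summit.ResolutionOfSingularities.ResolutionOfSingularities.Theses.RadicialJung.CleanModels) :
    ∀ (p : ℕ), p.Prime → p ≠ 2 →
    ∀ (k : Type) [Field k] [CharP k p] (K : Type) [Field K] [Algebra k K]
    (O : ValuationSubring K) (A : Subalgebra k K), A.toSubring ≤ O.toSubring → A.FG → IsFractionRing A K →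
    ringKrullDim A ≤ 3 → IsRegularLocalRing (locAtCentre A.toSubring O) →
    ringKrullDim (locAtCentre A.toSubring O) = 3 →
    (∀ (T : Subring K) (hT : T ≤ O.toSubring), A.toSubring ≤ T → (subringCentre T O hT).IsMaximal) →
    ∀ g₀ : K, (∀ c : K, c ^ p ≠ g₀) →
    (∀ f₀ : K, ∃ f₁ : K, O.valuation (g₀ - f₁ ^ p) < O.valuation (g₀ - f₀ ^ p)) →
    (∀ hk : ∀ c : k, algebraMap k K c ∈ O, transcendenceDefect k O hk ≠ 0) →
    ¬ (∃ π : K, π ≠ 0 ∧ (∀ x : K, O.valuation x < 1 → O.valuation x ≤ O.valuation π) ∧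
      (∀ x : K, x ≠ 0 → ∃ n : ℕ, O.valuation π ^ n ≤ O.valuation x)) →
    ¬ (∃ (O₁ : ValuationSubring K), O ≤ O₁ ∧ O₁ ≠ ⊤ ∧ ∃ y : Fin 2 → K, (∀ i, y i ∈ O) ∧
      ∀ P : MvPolynomial (Fin 2) k, P ≠ 0 → O₁.valuation (MvPolynomial.aeval y P) = 1) →
    ¬ ((∃ x y : K, x ≠ 0 ∧ y ≠ 0 ∧ ∀ a b : ℕ, a < p → b < p → (a ≠ 0 ∨ b ≠ 0) →
        ∀ z : K, z ≠ 0 → O.valuation (x ^ a * y ^ b) ≠ O.valuation (z ^ p)) ∧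
      ∃ r : ℕ, Module.finrank (Subfield.closure (Set.range (fun x : k => x ^ p))) k = p ^ r ∧
        Module.finrank (Subfield.closure (Set.range (fun x : IsLocalRing.ResidueField O => x ^ p))) (IsLocalRing.ResidueField O) = p ^ r) →
    ¬ ((∃ x y : K, x ≠ 0 ∧ y ≠ 0 ∧ ∀ a b : ℕ, a < p → b < p → (a ≠ 0 ∨ b ≠ 0) →
        ∀ z : K, z ≠ 0 → O.valuation (x ^ a * y ^ b) ≠ O.valuation (z ^ p)) ∧
      ∃ k' : IntermediateField k K, FiniteDimensional k k' ∧
        (∃ (n : ℕ) (s : Fin n → K), AlgebraicIndependent k' s ∧ Algebra.IsSeparable (IntermediateField.adjoin k' (Set.range s)) K) ∧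
        ∃ _ : Algebra k' (IsLocalRing.ResidueField O),
          (∀ (c : k') (h : algebraMap k' K c ∈ O),
            algebraMap k' (IsLocalRing.ResidueField O) c = IsLocalRing.residue O ⟨algebraMap k' K c, h⟩) ∧
          Algebra.IsSeparable k' (IsLocalRing.ResidueField O)) →
    ¬ IsAlgClosed k →
    ¬ (∃ O₁ : ValuationSubring K, O ≤ O₁ ∧ O₁ ≠ O ∧ O₁ ≠ ⊤) →
    ¬ (∃ (A' : Subalgebra k K) (_ : A'.toSubring ≤ O.toSubring) (_ : A ≤ A') (_ : A'.FG)
        (_ : IsRegularLocalRing (locAtCentre A'.toSubring O)) (c : Fin p → K) (_ : ∃ j : Fin p, (j : ℕ) ≠ 0 ∧ c j ≠ 0)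
        (h : ↥(locAtCentre A'.toSubring O)) (_ : (∑ j : Fin p, c j ^ p * g₀ ^ (j : ℕ)) = (h : K))
        (d : ℕ) (_ : 0 < d) (_ : (IsLocalRing.maximalIdeal ↥(locAtCentre A'.toSubring O)).spanFinrank = d)
        (t : Fin d → ↥(locAtCentre A'.toSubring O)) (_ : Ideal.span (Set.range t) = IsLocalRing.maximalIdeal ↥(locAtCentre A'.toSubring O))
        (F : MvPolynomial (Fin d) ↥(locAtCentre A'.toSubring O)) (e N : ℕ) (_ : F.IsHomogeneous e) (_ : ¬ p ∣ e) (_ : e ≤ N + 1),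
        h - MvPolynomial.aeval t F ∈ IsLocalRing.maximalIdeal ↥(locAtCentre A'.toSubring O) ^ (e + 1) ∧
        ∀ i, ∃ b : Fin d → ↥(locAtCentre A'.toSubring O),
          (∀ l, b l ∈ IsLocalRing.maximalIdeal ↥(locAtCentre A'.toSubring O) ^ (N + 1 - e)) ∧
          t i ^ N - ∑ l, b l * MvPolynomial.aeval t (MvPolynomial.pderiv l F) ∈
            IsLocalRing.maximalIdeal ↥(locAtCentre A'.toSubring O) ^ (N + 1)) →
    ∃ (A' : Subalgebra k K), A'.toSubring ≤ O.toSubring ∧ A ≤ A' ∧ A'.FG ∧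
    ∃ (_ : IsRegularLocalRing (locAtCentre A'.toSubring O)) (c : Fin p → K), (∃ j : Fin p, (j : ℕ) ≠ 0 ∧ c j ≠ 0) ∧
    ((∃ (d m : ℕ) (hmd : m ≤ d) (t : Fin d → ↥(locAtCentre A'.toSubring O)) (a : Fin m → ℕ) (u : ↥(locAtCentre A'.toSubring O)), IsUnit u ∧
    Ideal.span (Set.range t) = IsLocalRing.maximalIdeal ↥(locAtCentre A'.toSubring O) ∧
    ringKrullDim ↥(locAtCentre A'.toSubring O) = (d : WithBot ℕ∞) ∧ 0 < m ∧ (∀ i, ¬ p ∣ a i) ∧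
    (∑ j : Fin p, c j ^ p * g₀ ^ (j : ℕ)) = (u : K) * ∏ i : Fin m, ((t (Fin.castLE hmd i) : ↥(locAtCentre A'.toSubring O)) : K) ^ (a i)) ∨
    (∃ u : ↥(locAtCentre A'.toSubring O), IsUnit u ∧ (∑ j : Fin p, c j ^ p * g₀ ^ (j : ℕ)) = (u : K) ∧
    ∀ c' : ↥(locAtCentre A'.toSubring O), u - c' ^ p ∉ IsLocalRing.maximalIdeal ↥(locAtCentre A'.toSubring O)) ∨
    (∃ s c' : ↥(locAtCentre A'.toSubring O), (∑ j : Fin p, c j ^ p * g₀ ^ (j : ℕ)) = (s : K) ∧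
    s - c' ^ p ∈ IsLocalRing.maximalIdeal ↥(locAtCentre A'.toSubring O) ∧
    s - c' ^ p ∉ IsLocalRing.maximalIdeal ↥(locAtCentre A'.toSubring O) ^ 2)) := by
  intro p hp _ k _ _ K _ _ O A hAO hAfg hfrac hdimA hreg hdim3 hzd g₀ hg₀ _ _ _ _ _ _ _ _ _
  have hCM : ∀ p : ℕ, p.Prime → ∀ (k : Type) [Field k] [CharP k p] (W : AlgebraicGeometry.Scheme.{0}) [AlgebraicGeometry.IsIntegral W] (f : W ⟶ AlgebraicGeometry.Spec (.of k)) (L : Type) [Field L] [Algebra W.functionField L], AlgebraicGeometry.IsSeparated f → AlgebraicGeometry.LocallyOfFiniteType f → AlgebraicGeometry.QuasiCompact f → Literature.AlgebraicGeometry.Resolution.Scheme.IsRegular W → IsPurelyInseparable W.functionField L → Module.finrank W.functionField L = p → topologicalKrullDim W ≤ ((3 : ℕ) : WithBot ℕ∞) → ∃ (V : AlgebraicGeometry.Scheme.{0}) (π : V ⟶ W) (_ : AlgebraicGeometry.IsIntegral V) (_ : AlgebraicGeometry.IsDominant π), AlgebraicGeometry.IsProper π ∧ Literature.AlgebraicGeometry.Resolution.IsBirational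 π ∧ Literature.AlgebraicGeometry.Resolution.Scheme.IsRegular V ∧ (∀ v : V, (∃ (y : L) (g : W.functionField), y ∉ Set.range (algebraMap W.functionField L) ∧ algebraMap W.functionField L g = y ^ p ∧ ((∃ (d m : ℕ) (hmd : m ≤ d) (t : Fin d → V.presheaf.stalk v) (a : Fin m → ℕ), Ideal.span (Set.range t) = IsLocalRing.maximalIdeal (V.presheaf.stalk v) ∧ ringKrullDim (V.presheaf.stalk v) = (d : WithBot ℕ∞) ∧ 0 < m ∧ (∀ i, ¬ p ∣ a i) ∧ Literature.AlgebraicGeometry.Motives.RatFn.functionFieldMap π g = ∏ i : Fin m, (algebraMap (V.presheaf.stalk v) V.functionField (t (Fin.castLE hmd i))) ^ (a i)) ∨ (∃ u₀ : V.presheaf.stalk v, IsUnit u₀ ∧ Literature.AlgebraicGeometry.Motives.RatFn.functionFieldMap π g = algebraMap (V.presheaf.stalk v) V.functionField u₀ ∧ ((∀ c : V.presheaf.stalk v, u₀ - c ^ p ∉ IsLocalRing.maximalIdeal (V.presheaf.stalk v)) ∨ (∃ c : V.presheaf.stalk v, u₀ - c ^ p ∈ IsLocalRing.maximalIdeal (V.presheaf.stalk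 v) ∧ u₀ - c ^ p ∉ IsLocalRing.maximalIdeal (V.presheaf.stalk v) ^ 2)))))) :=
    fun p hp k _ _ W _ f L _ _ hs hl hq hr hpi hd _ => h p hp k W f L hs hl hq hr hpi hd
  exact cleanLUZeroDim_of_cleanModelsDimLE 3 hCM 3 le_rfl p hp k K O A hAO hAfg hfrac (by simpa using hdimA) hreg
    (by simpa using hdim3) hzd g₀ hg₀

/-- **The frontier stub is NECESSARY for the crux** (trivially: it IS the crux restricted to `dim W ≥ 4`): `Theses.RadicialJung.CleanModels` implies the
registered stub `stub_cleanModelsDimGEFour` VERBATIM. [folklore] -/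
theorem stub_cleanModelsDimGEFour_of_cleanModels
    (h : Summit.ResolutionOfSingularities.ResolutionOfSingularities.Theses.RadicialJung.CleanModels) :
    ∀ p : ℕ, p.Prime → ∀ (k : Type) [Field k] [CharP k p] (W : AlgebraicGeometry.Scheme.{0}) [AlgebraicGeometry.IsIntegral W] (f : W ⟶ AlgebraicGeometry.Spec (.of k)) (L : Type) [Field L] [Algebra W.functionField L], AlgebraicGeometry.IsSeparated f → AlgebraicGeometry.LocallyOfFiniteType f → AlgebraicGeometry.QuasiCompact f → Literature.AlgebraicGeometry.Resolution.Scheme.IsRegular W → IsPurelyInseparable W.functionField L → Module.finrank W.functionField L = p → ¬ topologicalKrullDim W ≤ 3 → ∃ (V : AlgebraicGeometry.Scheme.{0}) (π : V ⟶ W) (_ : AlgebraicGeometry.IsIntegral V) (_ : AlgebraicGeometry.IsDominant π), AlgebraicGeometry.IsProper π ∧ Literature.AlgebraicGeometry.Resolution.IsBirational π ∧ Literature.AlgebraicGeometry.Resolution.Scheme.IsRegular V ∧ (∀ v : V, (∃ (y : L) (g : W.functionField), y ∉ Set.range (algebraMap W.functionField L) ∧ algebraMap W.functionField L g = y ^ p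 ∧ ((∃ (d m : ℕ) (hmd : m ≤ d) (t : Fin d → V.presheaf.stalk v) (a : Fin m → ℕ), Ideal.span (Set.range t) = IsLocalRing.maximalIdeal (V.presheaf.stalk v) ∧ ringKrullDim (V.presheaf.stalk v) = (d : WithBot ℕ∞) ∧ 0 < m ∧ (∀ i, ¬ p ∣ a i) ∧ Literature.AlgebraicGeometry.Motives.RatFn.functionFieldMap π g = ∏ i : Fin m, (algebraMap (V.presheaf.stalk v) V.functionField (t (Fin.castLE hmd i))) ^ (a i)) ∨ (∃ u₀ : V.presheaf.stalk v, IsUnit u₀ ∧ Literature.AlgebraicGeometry.Motives.RatFn.functionFieldMap π g = algebraMap (V.presheaf.stalk v) V.functionField u₀ ∧ ((∀ c : V.presheaf.stalk v, u₀ - c ^ p ∉ IsLocalRing.maximalIdeal (V.presheaf.stalk v)) ∨ (∃ c : V.presheaf.stalk v, u₀ - c ^ p ∈ IsLocalRing.maximalIdeal (V.presheaf.stalk v) ∧ u₀ - c ^ p ∉ IsLocalRing.maximalIdeal (V.presheaf.stalk v) ^ 2)))))) :=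
  fun p hp k _ _ W _ f L _ _ hs hl hq hr hpi hd _ => h p hp k W f L hs hl hq hr hpi hd

end Summit.ResolutionOfSingularities.ResolutionOfSingularities.Theorems.RadicialJung.CleanModels

end
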